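import Literature.NumberTheory.LFunctions.UniformWeilPositivityRH
import Literature.NumberTheory.LFunctions.WeilDilationVirialDeriv
import Literature.NumberTheory.LFunctions.WeilFirstPrimePositivityC
import HarnessLib

/-!
# Yoshida's positivity threshold (Yoshida 1992, Proposition 6): the set of Weil-positive windows is a closed initial segment

H. Yoshida, *On Hermitian forms attached to zeta functions*, in: Zeta Functions in Geometry (Tokyo 1990),
Adv. Stud. Pure Math. **21** (1992), 281–325 (bib `Yoshida1992HermitianForms`; held copy
`paper:url-4f57c7fe9c4c`), §8, **Proposition 6** (p. 320, proof pp. 320–321), verbatim: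

> Assume that the Riemann hypothesis does not hold for `ζ_k(s)`. Then there exists `a₀ > 0` which
> has the following properties. (1) If `a ≤ a₀`, `( , )|K(a)` is positive semi-definite and
> `( , )|C(a)` is positive definite. (2) If `a > a₀`, both of `( , )|K(a)` and `( , )|C(a)` are not
> positive semi-definite.

Here `C(a) = {φ ∈ C_c^∞(ℝ) : supp φ ⊆ [−a, a]}` (p. 281), `(φ, ψ) = T_k(φ ∗ ψ̃)` is Weil's hermitian
form (p. 281, p. 284), and `k` is a number field. Yoshida's proof: the set
`I′ = {a > 0 : ( , )|C(a) is positive semi-definite}` is an initial segment (trivially), it is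
bounded when RH fails (Weil's criterion, "`C_c^∞(ℝ) = ⋃ C(a_i)`", p. 320), and it is CLOSED because
`(α_t, α_t) = T_k((α ∗ α̃)_t)` is continuous in the dilation parameter `t` (Lemma 7, p. 312), so
that a negative value at `a` propagates to a neighbourhood of `a`; hence `I′ = (0, a₀]`.

## What is proved here (the case `k = ℚ`, the part of Prop. 6 about `C(a)`, semidefinite form)

In the normalisation of this directory (`WeilExplicit.lean`: `IsWeilTest` = `C_c^∞`,
`Q(g) = weilQuadratic g = W(g ⋆ g̃)`, `WeilPositivityOn a` = "`Re Q(g) ≥ 0` for every test `g` with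
`tsupport g ⊆ [−a, a]`" = positive SEMI-definiteness of `( , )` on `C(a)` for `k = ℚ`, by the
explicit formula `explicit_formula_holds`):

* `WeilPositivityOn.of_forall_lt` — CLOSEDNESS (Yoshida's Lemma 7 step): if `Re Q ≥ 0` on `C(b)`
  for every `0 < b < a`, then `Re Q ≥ 0` on `C(a)`. Proof as in Yoshida, with Bombieri's unitary
  dilation `g_η(t) = (1+η)^{1/2} g((1+η)t)` (`weilDilate`, Bombieri 2000 §4 proof of Thm. 5): for
  `η > 0`, `g_η ∈ C(a/(1+η))` (`tsupport_weilDilate_subset`), and `η ↦ Re Q(g_η)` is continuous at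
  `η = 0` — indeed differentiable, `hasDerivAt_re_weilQuadratic_weilDilate`
  (`WeilDilationVirialDeriv.lean`) — so `Re Q(g) = lim_{η → 0⁺} Re Q(g_η) ≥ 0`.
* `weilPositivityThreshold` — Yoshida's `a₀ := sup {a > 0 : WeilPositivityOn a}` (a real `sSup`;
  meaningful when RH fails, junk value otherwise — see the docstring).
* `Yoshida1992_prop6` — **Proposition 6 for `C(a)`, `k = ℚ`**: if `¬ RiemannHypothesis` then
  `a₀ = weilPositivityThreshold` satisfies `(log 3)/2 ≤ a₀`, `WeilPositivityOn a` for every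
  `a ≤ a₀`, and `¬ WeilPositivityOn a` for every `a > a₀`. The lower bound `(log 3)/2` (Yoshida
  has `(log 2)/2` from his Thm. 1) is the tree's theorem `weilPositivityOn_log_three_half`
  (`WeilFirstPrimePositivityC.lean`); boundedness is Weil's criterion in Yoshida's form,
  `riemannHypothesis_iff_forall_weilPositivityOn` (`UniformWeilPositivityRH.lean`).
* `riemannHypothesis_or_exists_threshold` — the unconditional dichotomy: RH, or a finite break
  point `a₀ ≥ (log 3)/2` beyond which EVERY window fails.

Deliberately NOT here: Yoshida's space `K(a)` (periodic `C^∞` functions cut off at `±a`) and the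
`K(a)` half of Prop. 6; the positive-DEFINITENESS on `C(a)` for `a ≤ a₀` in (1) (it needs Prop. 2,
non-degeneracy of `( , )` on `C(a)`, p. 291, not in the tree); general number fields `k`
(`TODO(general form)`: the directory's Weil functional is `ζ_ℚ` only). No definitions of
mathematical objects beyond the threshold number; no named facts; everything is proved.
-/

noncomputable section

open Filter Set
open scoped Topology

namespace Literature.NumberTheory.LFunctions

/-- **Closedness of the set of Weil-positive windows** (the Lemma 7 step in Yoshida's proof of
Prop. 6, p. 320: "`J` is open and `I` is a closed subset of `ℝ₊`"): if Weil positivity holds on every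
strictly smaller window `[−b, b]`, `0 < b < a`, then it holds on `[−a, a]`. Proof by Bombieri's
dilation `g_η`, `η → 0⁺`, and continuity of `η ↦ Re Q(g_η)` at `0`.
[cite: Yoshida1992HermitianForms, Prop. 6 (p. 320) with Lemma 7 (p. 312)] -/
theorem WeilPositivityOn.of_forall_lt {a : ℝ} (ha : 0 < a)
    (h : ∀ b : ℝ, 0 < b → b < a → WeilPositivityOn b) : WeilPositivityOn a := by
  intro g hg hsupp
  -- `φ η = Re Q(g_η)` is continuous at `η = 0` and `φ 0 = Re Q(g)`.
  have hcont : Tendsto (fun η : ℝ ↦ (weilQuadratic (weilDilate η g)).re) (𝓝[>] 0)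
      (𝓝 ((weilQuadratic (weilDilate 0 g)).re)) :=
    ((hasDerivAt_re_weilQuadratic_weilDilate hg).continuousAt.tendsto).mono_left
      nhdsWithin_le_nhds
  rw [weilDilate_zero] at hcont
  -- for `η > 0` the dilate lives on the window `a/(1+η) < a`, where positivity holds.
  refine ge_of_tendsto hcont (eventually_nhdsWithin_of_forall fun η (hη : 0 < η) ↦ ?_)
  have hη' : (-1 : ℝ) < η := by linarith
  have hlt : a / (1 + η) < a := by
    rw [div_lt_iff₀ (by linarith : (0 : ℝ) < 1 + η)]
    nlinarith
  have hpos : 0 < a / (1 + η) := div_pos ha (by linarith)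
  exact h (a / (1 + η)) hpos hlt (weilDilate η g) (hg.weilDilate hη')
    (tsupport_weilDilate_subset g hη' hsupp)

/-- **Yoshida's threshold** `a₀ := sup {a > 0 : Weil positivity holds on [−a, a]}` (Yoshida 1992,
proof of Prop. 6, p. 320: "Let `a₁` be the maximum of `I` … there exists a maximum `a₀` of `I′`";
here `I′` for `C(a)`, `k = ℚ`). A real `sSup`: when the Riemann hypothesis FAILS the set is
non-empty and bounded above and `a₀` is its maximum (`Yoshida1992_prop6`); when RH holds the set is
all of `(0, ∞)` (`riemannHypothesis_iff_forall_weilPositivityOn`), unbounded, and `sSup` returns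
the junk value `0` — the number is only used under `¬ RiemannHypothesis`.
[cite: Yoshida1992HermitianForms, Prop. 6 (p. 320)] -/
def weilPositivityThreshold : ℝ :=
  sSup {a : ℝ | 0 < a ∧ WeilPositivityOn a}

/-- The window `(log 3)/2` is Weil-positive (the tree's theorem `weilPositivityOn_log_three_half`),
so it belongs to Yoshida's set `I′`. [cite: Yoshida1992HermitianForms, Thm. 1 (p. 310) for (log 2)/2] -/
theorem log_three_half_mem_weilPositivitySet :
    Real.log 3 / 2 ∈ {a : ℝ | 0 < a ∧ WeilPositivityOn a} :=
  ⟨by positivity, weilPositivityOn_log_three_half⟩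

/-- If RH fails, Yoshida's set `I′ = {a > 0 : WeilPositivityOn a}` is bounded above (by any window
on which positivity fails: the set is an initial segment, `WeilPositivityOn.mono`).
[cite: Yoshida1992HermitianForms, Prop. 6 (p. 320), "Then I is bounded"] -/
theorem bddAbove_weilPositivitySet_of_not_riemannHypothesis (hRH : ¬ RiemannHypothesis) :
    BddAbove {a : ℝ | 0 < a ∧ WeilPositivityOn a} := by
  have h : ¬ ∀ a : ℝ, 0 < a → WeilPositivityOn a :=
    fun h' ↦ hRH (riemannHypothesis_iff_forall_weilPositivityOn.2 h')
  push Not at h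
  obtain ⟨b, _, hb⟩ := h
  refine ⟨b, fun a ha ↦ ?_⟩
  by_contra hab
  exact hb (WeilPositivityOn.mono (le_of_not_ge hab) ha.2)

/-- **Yoshida 1992, Proposition 6** (the `C(a)` part, `k = ℚ`, semidefinite form; Adv. Stud. Pure
Math. 21, p. 320): "Assume that the Riemann hypothesis does not hold … Then there exists `a₀ > 0` …
(1) If `a ≤ a₀`, … `( , )|C(a)` is positive [semi-]definite. (2) If `a > a₀`, … `( , )|C(a)` [is]
not positive semi-definite." With `a₀ = weilPositivityThreshold` and the tree's lower bound
`(log 3)/2 ≤ a₀` (Yoshida: `(log 2)/2`, Thm. 1).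
[cite: Yoshida1992HermitianForms, Prop. 6 (p. 320)] -/
theorem Yoshida1992_prop6 (hRH : ¬ RiemannHypothesis) :
    Real.log 3 / 2 ≤ weilPositivityThreshold ∧
      (∀ a : ℝ, a ≤ weilPositivityThreshold → WeilPositivityOn a) ∧
      (∀ a : ℝ, weilPositivityThreshold < a → ¬ WeilPositivityOn a) := by
  have hbdd := bddAbove_weilPositivitySet_of_not_riemannHypothesis hRH
  have hne : {a : ℝ | 0 < a ∧ WeilPositivityOn a}.Nonempty := ⟨_, log_three_half_mem_weilPositivitySet⟩
  have hlow : Real.log 3 / 2 ≤ weilPositivityThreshold :=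
    le_csSup hbdd log_three_half_mem_weilPositivitySet
  have hpos : 0 < weilPositivityThreshold := lt_of_lt_of_le (by positivity) hlow
  -- positivity AT the threshold, by closedness
  have hat : WeilPositivityOn weilPositivityThreshold := by
    refine WeilPositivityOn.of_forall_lt hpos fun b hb hblt ↦ ?_
    obtain ⟨c, hc, hbc⟩ := exists_lt_of_lt_csSup hne hblt
    exact WeilPositivityOn.mono hbc.le hc.2
  refine ⟨hlow, fun a ha ↦ WeilPositivityOn.mono ha hat, fun a ha hWa ↦ ?_⟩
  have hmem : a ∈ {a : ℝ | 0 < a ∧ WeilPositivityOn a} := ⟨hpos.trans ha, hWa⟩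
  exact not_le_of_gt ha (le_csSup hbdd hmem)

/-- **The unconditional dichotomy behind Yoshida's Prop. 6**: either the Riemann hypothesis holds,
or there is a finite break point `a₀ ≥ (log 3)/2` such that Weil positivity holds on every window
`[−a, a]` with `a ≤ a₀` and FAILS on every window with `a > a₀`.
[cite: Yoshida1992HermitianForms, Prop. 6 (p. 320)] -/
theorem riemannHypothesis_or_exists_threshold :
    RiemannHypothesis ∨
      ∃ a₀ : ℝ, Real.log 3 / 2 ≤ a₀ ∧ (∀ a : ℝ, a ≤ a₀ → WeilPositivityOn a) ∧
        (∀ a : ℝ, a₀ < a → ¬ WeilPositivityOn a) := by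
  by_cases hRH : RiemannHypothesis
  · exact Or.inl hRH
  · exact Or.inr ⟨weilPositivityThreshold, Yoshida1992_prop6 hRH⟩

/-- Conversely, a failure of Weil positivity on some window refutes RH (Weil's criterion), so the
second alternative of `riemannHypothesis_or_exists_threshold` is equivalent to `¬ RiemannHypothesis`.
[cite: Yoshida1992HermitianForms, §0 p. 281 (Weil's observation) and Prop. 6] -/
theorem not_riemannHypothesis_iff_exists_threshold :
    ¬ RiemannHypothesis ↔
      ∃ a₀ : ℝ, Real.log 3 / 2 ≤ a₀ ∧ (∀ a : ℝ, a ≤ a₀ → WeilPositivityOn a) ∧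
        (∀ a : ℝ, a₀ < a → ¬ WeilPositivityOn a) := by
  constructor
  · exact fun hRH ↦ ⟨weilPositivityThreshold, Yoshida1992_prop6 hRH⟩
  · rintro ⟨a₀, ha₀, -, hfail⟩ hRH
    have hpos : 0 < a₀ + 1 := by
      have : 0 < Real.log 3 / 2 := by positivity
      linarith
    exact hfail (a₀ + 1) (by linarith)
      (riemannHypothesis_iff_forall_weilPositivityOn.1 hRH (a₀ + 1) hpos)

end Literature.NumberTheory.LFunctions

end
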